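import Literature.AlgebraicGeometry.Resolution.ProperModelsJoin
import Literature.AlgebraicGeometry.Resolution.ProperModelsFunctionField
import Literature.AlgebraicGeometry.Resolution.ProjectiveModelsCharts
import Literature.AlgebraicGeometry.Resolution.ResolutionProjectiveReduction
import Literature.AlgebraicGeometry.Resolution.AffineDomainDimension
import Literature.AlgebraicGeometry.Resolution.AlterationsDimension
import Literature.AlgebraicGeometry.Resolution.BirationalLocalIso
import Mathlib.FieldTheory.SeparablyGenerated
import Mathlib.FieldTheory.PrimitiveElement
import HarnessLib

/-!
# `Pialt` (crux stmt-ResolutionOfSingularities-0555), line `IndeterminacySplit`: the hypersurface model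

Stub `stub_hypersurfaceModel` of the skeleton `indeterminacy-split`
(`Cruxes/Pialt/Lines/IndeterminacySplit.lean`; helper file,
`--supports stmt-ResolutionOfSingularities-0555`; does not close the item).

**Statement.** Every integral separated scheme `X` of finite type over a PERFECT field `k` is
birational to an integral hypersurface of a projective space: there are `n`, an integral closed
subscheme `H ⊆ ℙⁿ⁺¹_k` with `dim H = n`, and non-empty opens `U ⊆ X`, `W ⊆ H` with a
`k`-isomorphism `W ≅ U` (Hartshorne I, Prop. 4.9 with Cor. 4.5).

**Proof.** Let `U₀ = Spec A` be a non-empty affine open of `X` and `K := Frac A`, a finitely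
generated field extension of `k`.
* (`exists_generators_isFractionRing_of_perfectField`) `k` being perfect, `K/k` is separably
  generated (Mathlib `exists_isTranscendenceBasis_and_isSeparable_of_perfectField`: a finite
  transcendence basis `s` with `K/k(s)` separable), so `K = k(s)(θ)` by the primitive element
  theorem; with `n := |s| = trdeg_k K`, the `n + 1` elements `s, θ` generate a `k`-subalgebra
  `B = k[x₀, …, xₙ] ⊆ K` with `Frac B = K`.
* (`exists_isImmersion_projectiveSpace_of_surjective`) `Spec B ↪ 𝔸ⁿ⁺¹_k ≅ D₊(x₀) ⊆ ℙⁿ⁺¹_k` is an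
  immersion over `k`; its scheme-theoretic image `H` is an integral closed subscheme of `ℙⁿ⁺¹_k`
  containing `Spec B` as an open (`exists_projectiveClosure`), so
  `dim H = dim B = trdeg_k K = n` (`topologicalKrullDim_spec_eq_of_trdeg_eq`, Matsumura 5.6).
* (`exists_isOpenImmersion_span_of_properModel`) The projective closures `X̄ ⊇ U₀` and
  `H ⊇ Spec B` are two proper models of `K/k` (`ProjModel.ofChart`); their join `J` dominates
  both, each domination being an isomorphism over a non-empty open (Stacks 0BX6,
  `ProperModel.Hom.exists_isIso_morphismRestrict`), so a non-empty open `V` of `J` is openly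
  immersed over `k` in `U₀ ⊆ X` and in `H`; `U := V ↪ X`, `W := V ↪ H`, `e := W ≅ V ≅ U`.
No named facts are used.
-/

set_option linter.dupNamespace false -- mandated namespace of this single-conjunct summit

noncomputable section

open CategoryTheory CategoryTheory.Limits AlgebraicGeometry TopologicalSpace
open Literature.AlgebraicGeometry.Resolution

universe u

namespace Summit.ResolutionOfSingularities.ResolutionOfSingularities.Theorems.Pialt.IndeterminacySplit

/-! ## Affine charts of projective space with a prescribed number of coordinates -/

section Immersion

open MvPolynomial HomogeneousLocalization

/-- **`Spec` of a quotient of `k[y₁,…,yₘ]` is immersed in `ℙᵐ_k` over `k`**: the closed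
immersion `Spec B ↪ 𝔸ᵐ_k = Spec k[y₁,…,yₘ]` followed by the standard chart
`𝔸ᵐ_k ≅ D₊(x₀) ⊆ ℙᵐ_k` (`Literature.AlgebraicGeometry.Motives.ProjectiveSpace.chartAlgEquiv`).
[cite: GortzWedhorn2020, §(12.15) p. 440] -/
theorem exists_isImmersion_projectiveSpace_of_surjective (k : Type u) [Field k] {m : ℕ}
    (B : Type u) [CommRing B] [Algebra k B] (θ : MvPolynomial (Fin m) k →ₐ[k] B)
    (hθ : Function.Surjective θ) :
    ∃ ρ : Spec (.of B) ⟶ (Literature.AlgebraicGeometry.Motives.projectiveSpace m k).left,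
      IsImmersion ρ ∧ ρ ≫ (Literature.AlgebraicGeometry.Motives.projectiveSpace m k).hom =
        Spec.map (CommRingCat.ofHom (algebraMap k B)) := by
  -- adapted from `ChowLemmaProof.exists_immersion_projectiveSpace` (ChowLemmaProofs.lean)
  letI := MvPolynomial.gradedAlgebra (σ := Fin (m + 1)) (R := k)
  letI := Literature.AlgebraicGeometry.Motives.ProjBaseChange.algebraBase
    (homogeneousSubmodule (Fin (m + 1)) k) (Submonoid.powers (X 0 : MvPolynomial (Fin (m + 1)) k))
  let e := Literature.AlgebraicGeometry.Motives.ProjectiveSpace.chartAlgEquiv k (0 : Fin (m + 1))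
  let φ : Away (homogeneousSubmodule (Fin (m + 1)) k) (X 0) →+* B :=
    θ.toRingHom.comp e.toRingEquiv.toRingHom
  have hφ : Function.Surjective φ := hθ.comp e.surjective
  have hφk : φ.comp (algebraMap k _) = algebraMap k B := by
    ext c
    change θ (e (algebraMap k _ c)) = algebraMap k B c
    rw [e.commutes, θ.commutes]
  haveI : IsClosedImmersion (Spec.map (CommRingCat.ofHom φ)) :=
    IsClosedImmersion.spec_of_surjective _ hφ
  have h2 : IsImmersion (Spec.map (CommRingCat.ofHom φ) ≫
      Proj.awayι (homogeneousSubmodule (Fin (m + 1)) k) (X 0)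
        (Literature.AlgebraicGeometry.Motives.ProjectiveSpace.X_mem 0) zero_lt_one) :=
    IsImmersion.comp _ _
  refine ⟨Spec.map (CommRingCat.ofHom φ) ≫
      Proj.awayι (homogeneousSubmodule (Fin (m + 1)) k) (X 0)
        (Literature.AlgebraicGeometry.Motives.ProjectiveSpace.X_mem 0) zero_lt_one,
    h2, ?_⟩
  change (_ ≫ _) ≫ Literature.AlgebraicGeometry.Motives.ProjBaseChange.projToSpec (Fin (m + 1)) k
    = _
  rw [Category.assoc, Literature.AlgebraicGeometry.Motives.ProjBaseChange.awayι_projToSpec,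
    ← Spec.map_comp, ← CommRingCat.ofHom_comp, hφk]

end Immersion

/-! ## Generators of a finitely generated extension of a perfect field -/

/-- **`K = Frac k[x₀, …, xₙ]` with `n = trdeg_k K` over a perfect field.** A finitely generated
field extension `K` of a PERFECT field `k` is separably generated (Mathlib
`exists_isTranscendenceBasis_and_isSeparable_of_perfectField`: a transcendence basis `s`,
finite, with `K / k(s)` separable), so by the primitive element theorem `K = k(s)(θ)`; hence the
`n + 1` elements `s, θ` (`n = |s| = trdeg_k K`) generate a `k`-subalgebra with fraction field
`K`. [cite: Hartshorne1977, I Thm. 4.8A and Prop. 4.9 (proof)] -/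
theorem exists_generators_isFractionRing_of_perfectField (k K : Type u) [Field k] [Field K]
    [Algebra k K] [PerfectField k] [Algebra.EssFiniteType k K] :
    ∃ (n : ℕ) (x : Fin (n + 1) → K), Algebra.trdeg k K = n ∧
      IsFractionRing (MvPolynomial.aeval (R := k) x).range K := by
  obtain ⟨s, hs, hsep⟩ := exists_isTranscendenceBasis_and_isSeparable_of_perfectField k K
  haveI := hsep
  set k' := IntermediateField.adjoin k (s : Set K)
  haveI : Algebra.EssFiniteType k' K := Algebra.EssFiniteType.of_comp k k' K
  haveI : Algebra.IsAlgebraic k' K := Algebra.IsSeparable.isAlgebraic k' K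
  haveI : FiniteDimensional k' K := Algebra.finite_of_essFiniteType_of_isAlgebraic
  obtain ⟨θ, hθ⟩ := Field.exists_primitive_element k' K
  -- `K = k(s ∪ {θ})`
  have htop : IntermediateField.adjoin k ((s : Set K) ∪ {θ}) = ⊤ := by
    rw [← IntermediateField.adjoin_adjoin_left, hθ, IntermediateField.restrictScalars_top]
  -- enumerate the `n + 1` generators
  set n := s.card
  let e : Fin n ≃ (s : Set K) := s.equivFin.symm
  let x : Fin (n + 1) → K := Fin.cons (α := fun _ => K) θ fun i => (e i : K)
  have hrange : Set.range x = insert θ (s : Set K) := by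
    change Set.range (Fin.cons (α := fun _ => K) θ fun i => (e i : K)) = _
    rw [Fin.range_cons]
    congr 1
    change Set.range (Subtype.val ∘ e) = _
    rw [e.surjective.range_comp, Subtype.range_coe_subtype]
    rfl
  refine ⟨n, x, ?_, ?_⟩
  · rw [← hs.cardinalMk_eq_trdeg, Cardinal.mk_fintype, Fintype.card_coe]
  · rw [← Algebra.adjoin_range_eq_range_aeval, hrange]
    refine IsFractionRing.of_field _ _ fun z => ?_
    have hz : z ∈ IntermediateField.adjoin k (insert θ (s : Set K)) := by
      rw [← Set.union_singleton, htop]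
      exact IntermediateField.mem_top
    obtain ⟨r, hr, t, ht, hzrt⟩ := IntermediateField.mem_adjoin_iff_div.mp hz
    exact ⟨⟨r, hr⟩, ⟨t, ht⟩, hzrt⟩

/-! ## The dimension of an affine model -/

/-- **`dim Spec B = trdeg_k K`** for a finitely generated `k`-subalgebra `B ⊆ K` with
`Frac B = K` (Matsumura Thm. 5.6: the Krull dimension of an affine domain is the transcendence
degree of its fraction field). [cite: Matsumura1987, Thm. 5.6] -/
theorem topologicalKrullDim_spec_eq_of_trdeg_eq {k K : Type u} [Field k] [Field K] [Algebra k K]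
    (B : Subalgebra k K) [Algebra.FiniteType k B] [IsFractionRing B K] {n : ℕ}
    (hn : Algebra.trdeg k K = n) :
    topologicalKrullDim (Spec (.of B)) = (n : WithBot ℕ∞) := by
  obtain ⟨m, hdim, htr⟩ := exists_ringKrullDim_eq_and_trdeg_eq k B
  rw [trdeg_eq_trdeg_of_isFractionRing B, htr, Nat.cast_inj] at hn
  subst hn
  change topologicalKrullDim (PrimeSpectrum B) = _
  rw [PrimeSpectrum.topologicalKrullDim_eq_ringKrullDim]
  exact hdim

/-! ## Two proper models of one function field share an open -/

/-- **Two proper models of the same function field `K/k` have `k`-isomorphic non-empty opens**,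
the open of the first inside any prescribed non-empty open `O`: the join `J` of `M₁, M₂`
(closure of the diagonal `K`-point in `M₁ ×ₖ M₂`, `ProperModel.join`) dominates both, and a
morphism of proper models of one field is an isomorphism over a non-empty open of its target
(`ProperModel.Hom.exists_isIso_morphismRestrict`, Stacks 0BX6); the non-empty open
`V := p₁⁻¹(U₁ ∩ O) ∩ p₂⁻¹(U₂)` of the irreducible `J` is then openly immersed in both by the two
projections. Stated as a span of open `k`-immersions `M₁ ← V → M₂`.
[cite: StacksProject, Tag 0BX6] -/
theorem exists_isOpenImmersion_span_of_properModel {k K : Type u} [Field k] [Field K] [Algebra k K]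
    (M₁ M₂ : ProperModel k K) (O : M₁.X.Opens) (hO : (O : Set M₁.X).Nonempty) :
    ∃ (V : Scheme.{u}) (i₁ : V ⟶ M₁.X) (i₂ : V ⟶ M₂.X), IsOpenImmersion i₁ ∧
      IsOpenImmersion i₂ ∧ Nonempty V ∧ i₁ ≫ M₁.π = i₂ ≫ M₂.π ∧
        Set.range i₁ ⊆ (O : Set M₁.X) := by
  let J := ProperModel.join M₁ M₂
  let φ₁ : J.Hom M₁ := ProperModel.joinFst M₁ M₂
  let φ₂ : J.Hom M₂ := ProperModel.joinSnd M₁ M₂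
  obtain ⟨U₁, hU₁, hiso₁, -⟩ := φ₁.exists_isIso_morphismRestrict
  obtain ⟨U₂, hU₂, hiso₂, -⟩ := φ₂.exists_isIso_morphismRestrict
  haveI := hiso₁
  haveI := hiso₂
  -- the non-empty open `V := φ₁⁻¹(U₁ ∩ O) ∩ φ₂⁻¹(U₂)` of the irreducible `J`
  let V : J.X.Opens := φ₁.f ⁻¹ᵁ (U₁ ⊓ O) ⊓ φ₂.f ⁻¹ᵁ U₂
  have hV₁ : ((φ₁.f ⁻¹ᵁ (U₁ ⊓ O) : J.X.Opens) : Set J.X).Nonempty := by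
    have h : ((U₁ ⊓ O : M₁.X.Opens) : Set M₁.X).Nonempty := by
      rw [Opens.coe_inf, Set.inter_comm]
      exact (U₁.2.dense hU₁).inter_open_nonempty O O.isOpen hO
    haveI : Nonempty (U₁ ⊓ O : M₁.X.Opens) := h.to_subtype
    obtain ⟨z⟩ := nonempty_preimage_of_isDominant φ₁.f (U₁ ⊓ O)
    exact ⟨z.1, z.2⟩
  have hV₂ : ((φ₂.f ⁻¹ᵁ U₂ : J.X.Opens) : Set J.X).Nonempty := by
    haveI : Nonempty U₂ := hU₂.to_subtype
    obtain ⟨z⟩ := nonempty_preimage_of_isDominant φ₂.f U₂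
    exact ⟨z.1, z.2⟩
  have hV : (V : Set J.X).Nonempty := by
    change ((φ₁.f ⁻¹ᵁ (U₁ ⊓ O) ⊓ φ₂.f ⁻¹ᵁ U₂ : J.X.Opens) : Set J.X).Nonempty
    rw [Opens.coe_inf, Set.inter_comm]
    exact ((φ₁.f ⁻¹ᵁ (U₁ ⊓ O)).2.dense hV₁).inter_open_nonempty _ (φ₂.f ⁻¹ᵁ U₂).isOpen hV₂
  have hle₁ : V ≤ φ₁.f ⁻¹ᵁ U₁ :=
    inf_le_left.trans (Scheme.Hom.preimage_mono φ₁.f inf_le_left)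
  have hle₂ : V ≤ φ₂.f ⁻¹ᵁ U₂ := inf_le_right
  -- the two projections restricted to `V` are open immersions
  have himm₁ : IsOpenImmersion (V.ι ≫ φ₁.f) := by
    rw [← Scheme.homOfLE_ι J.X hle₁, Category.assoc, ← morphismRestrict_ι]
    infer_instance
  have himm₂ : IsOpenImmersion (V.ι ≫ φ₂.f) := by
    rw [← Scheme.homOfLE_ι J.X hle₂, Category.assoc, ← morphismRestrict_ι]
    infer_instance
  refine ⟨V, V.ι ≫ φ₁.f, V.ι ≫ φ₂.f, himm₁, himm₂, ?_, ?_, ?_⟩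
  · obtain ⟨z, hz⟩ := hV
    exact ⟨⟨z, hz⟩⟩
  · rw [Category.assoc, Category.assoc, φ₁.f_π, φ₂.f_π]
  · rintro _ ⟨v, rfl⟩
    have hv : v.1 ∈ V := v.2
    exact (hv.1).2

/-! ## The hypersurface model -/

/-- **Every integral variety over a perfect field is birational to an integral hypersurface of a
projective space** (stub `stub_hypersurfaceModel` of the line `IndeterminacySplit`). For `X`
integral separated of finite type over a perfect field `k` there are `n`, an integral closed
subscheme `H ⊆ ℙⁿ⁺¹_k` of dimension `n`, and non-empty opens `U ⊆ X`, `W ⊆ H` with a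
`k`-isomorphism `W ≅ U`. Proof: with `U₀ = Spec A` a non-empty affine open of `X` and
`K = Frac A`, `K/k` is separably generated (`k` perfect), so `K = Frac k[x₀,…,xₙ]`,
`n = trdeg_k K`, by the primitive element theorem
(`exists_generators_isFractionRing_of_perfectField`); `B := k[x₀,…,xₙ] ⊆ K` gives a closed
subscheme `Spec B ⊆ 𝔸ⁿ⁺¹_k ⊆ ℙⁿ⁺¹_k` whose projective closure `H` is integral of dimension
`dim B = trdeg_k K = n`; the projective closures of `U₀` and of `Spec B` are two proper models
of `K/k`, which share a non-empty open (`exists_isOpenImmersion_span_of_properModel`, via the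
join of the two models). [cite: Hartshorne1977, I Prop. 4.9 and Cor. 4.5] -/
theorem stub_hypersurfaceModel (k : Type) [Field k] [PerfectField k] (X : Scheme.{0})
    (f : X ⟶ Spec (.of k)) [IsSeparated f] [LocallyOfFiniteType f] [QuasiCompact f]
    [IsIntegral X] :
    ∃ (n : ℕ) (H : Scheme.{0}) (ι : H ⟶ (Literature.AlgebraicGeometry.Motives.projectiveSpace (n + 1) k).left)
      (_ : IsClosedImmersion ι) (_ : IsIntegral H),
      topologicalKrullDim H = (n : WithBot ℕ∞) ∧
      ∃ (U : X.Opens) (W : H.Opens) (e : (W : Scheme.{0}) ⟶ (U : Scheme.{0})), IsIso e ∧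
        (U : Set X).Nonempty ∧ W.ι ≫ ι ≫ (Literature.AlgebraicGeometry.Motives.projectiveSpace (n + 1) k).hom = e ≫ U.ι ≫ f := by
  -- an affine chart `U₀ = Spec A` of `X` and `K := Frac A`
  obtain ⟨_, ⟨U', hU', rfl⟩, hηU, -⟩ := X.isBasis_affineOpens.exists_subset_of_mem_open
    (Set.mem_univ (genericPoint X)) isOpen_univ
  let U₀ : X.Opens := U'
  have hU₀ : IsAffineOpen U₀ := hU'
  haveI : IsAffine U₀ := hU₀
  haveI : Nonempty U₀ := ⟨⟨_, hηU⟩⟩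
  let A : Type := Γ(U₀, ⊤)
  let g : (U₀ : Scheme.{0}) ⟶ Spec (.of k) := U₀.ι ≫ f
  let ψ : k →+* A := g.appTop.hom.comp (Scheme.ΓSpecIso (.of k)).inv.hom
  have hψ : ψ.FiniteType := by
    have h1 : g.appTop.hom.FiniteType :=
      (HasRingHomProperty.iff_of_isAffine (P := @LocallyOfFiniteType)).mp inferInstance
    exact h1.comp (RingHom.FiniteType.of_surjective _
      (Scheme.ΓSpecIso (.of k)).symm.commRingCatIsoToRingEquiv.surjective)
  letI : Algebra k A := ψ.toAlgebra
  haveI hft : Algebra.FiniteType k A := hψ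
  let K : Type := FractionRing A
  haveI : Algebra.EssFiniteType k K := inferInstance
  -- the projective closure `X̄` of `U₀ ↪ ℙᴺ_k`, a projective model `M₁` of `K/k`
  obtain ⟨N, ρ₁, hρ₁, hρ₁g⟩ := ChowLemmaProof.exists_immersion_projectiveSpace k g
  haveI := hρ₁
  obtain ⟨Xb, jX, cX, hXb, hjX, hcX, hjc, -⟩ := exists_projectiveClosure ρ₁
  haveI := hXb
  haveI := hjX
  haveI := hcX
  haveI : IsProper (Literature.AlgebraicGeometry.Motives.projectiveSpace N k).hom :=
    Literature.AlgebraicGeometry.Motives.isProper_projectiveSpace N k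
  let πXb : Xb ⟶ Spec (.of k) := cX ≫ (Literature.AlgebraicGeometry.Motives.projectiveSpace N k).hom
  have hprojX : Literature.AlgebraicGeometry.Motives.IsProjectiveOver (Over.mk πXb) :=
    ⟨N, Over.homMk cX rfl, hcX⟩
  have hjXπ : jX ≫ πXb = g := by
    change jX ≫ cX ≫ _ = g
    rw [← Category.assoc, hjc, hρ₁g]
  let j₁ : Spec (.of A) ⟶ Xb := U₀.toScheme.isoSpec.inv ≫ jX
  have hj₁ : j₁ ≫ πXb = Spec.map (CommRingCat.ofHom (algebraMap k A)) := by
    change (U₀.toScheme.isoSpec.inv ≫ jX) ≫ πXb = Spec.map (CommRingCat.ofHom ψ)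
    rw [Category.assoc, hjXπ, isoSpec_inv_comp]
    rfl
  let M₁ : ProjModel k K := ProjModel.ofChart (K := K) Xb πXb hprojX A j₁ hj₁
  -- generators: `K = Frac B`, `B = k[x₀,…,xₙ]`, `n = trdeg_k K`
  obtain ⟨n, x, htr, hfr⟩ := exists_generators_isFractionRing_of_perfectField k K
  haveI := hfr
  let B : Subalgebra k K := (MvPolynomial.aeval (R := k) x).range
  haveI : Algebra.FiniteType k B :=
    Algebra.FiniteType.of_surjective (MvPolynomial.aeval x).rangeRestrict
      (AlgHom.rangeRestrict_surjective _)
  -- `Spec B ⊆ 𝔸ⁿ⁺¹_k ⊆ ℙⁿ⁺¹_k` and its projective closure `H`, a projective model `M₂` of `K/k`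
  obtain ⟨ρ, hρ, hρπ⟩ := exists_isImmersion_projectiveSpace_of_surjective k B
    (MvPolynomial.aeval x).rangeRestrict (AlgHom.rangeRestrict_surjective _)
  haveI := hρ
  obtain ⟨H, jB, ι, hH, hjB, hι, hjBι, hdimH⟩ := exists_projectiveClosure ρ
  haveI := hH
  haveI := hjB
  haveI := hι
  haveI : IsProper (Literature.AlgebraicGeometry.Motives.projectiveSpace (n + 1) k).hom :=
    Literature.AlgebraicGeometry.Motives.isProper_projectiveSpace (n + 1) k
  let πH : H ⟶ Spec (.of k) := ι ≫ (Literature.AlgebraicGeometry.Motives.projectiveSpace (n + 1) k).hom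
  have hprojH : Literature.AlgebraicGeometry.Motives.IsProjectiveOver (Over.mk πH) :=
    ⟨n + 1, Over.homMk ι rfl, hι⟩
  have hjBπ : jB ≫ πH = Spec.map (CommRingCat.ofHom (algebraMap k B)) := by
    change jB ≫ ι ≫ _ = _
    rw [← Category.assoc, hjBι, hρπ]
  let M₂ : ProjModel k K := ProjModel.ofChart (K := K) H πH hprojH B jB hjBπ
  -- `dim H = dim Spec B = trdeg_k K = n`
  have hdim : topologicalKrullDim H = (n : WithBot ℕ∞) := by
    rw [hdimH]
    exact topologicalKrullDim_spec_eq_of_trdeg_eq B htr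
  -- the two models share a non-empty open inside the chart `U₀` of `X̄`
  have hO : (jX.opensRange : Set Xb).Nonempty := by
    obtain ⟨u⟩ := (inferInstance : Nonempty U₀)
    exact ⟨jX u, by simp only [Scheme.Hom.coe_opensRange, Set.mem_range_self]⟩
  obtain ⟨V, i₁, i₂, hi₁, hi₂, hVne, hπ, hrange⟩ : ∃ (V : Scheme.{0}) (i₁ : V ⟶ Xb) (i₂ : V ⟶ H),
      IsOpenImmersion i₁ ∧ IsOpenImmersion i₂ ∧ Nonempty V ∧ i₁ ≫ πXb = i₂ ≫ πH ∧
        Set.range i₁ ⊆ (jX.opensRange : Set Xb) :=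
    exists_isOpenImmersion_span_of_properModel M₁.toProperModel M₂.toProperModel jX.opensRange hO
  haveI := hi₁
  haveI := hi₂
  have hrange' : Set.range i₁ ⊆ Set.range jX := fun y hy => hrange hy
  let i₁' : V ⟶ U₀ := IsOpenImmersion.lift jX i₁ hrange'
  have hi₁' : i₁' ≫ jX = i₁ := IsOpenImmersion.lift_fac _ _ _
  haveI : IsOpenImmersion i₁' := by
    have : IsOpenImmersion (i₁' ≫ jX) := by rw [hi₁']; exact hi₁
    exact IsOpenImmersion.of_comp i₁' jX
  let e₁ : V ⟶ X := i₁' ≫ U₀.ι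
  haveI : IsOpenImmersion e₁ := inferInstance
  refine ⟨n, H, ι, hι, hH, hdim, e₁.opensRange, i₂.opensRange,
    i₂.isoOpensRange.inv ≫ e₁.isoOpensRange.hom, inferInstance, ?_, ?_⟩
  · obtain ⟨v⟩ := hVne
    exact ⟨e₁ v, by simp only [Scheme.Hom.coe_opensRange, Set.mem_range_self]⟩
  · rw [← cancel_epi i₂.isoOpensRange.hom, Scheme.Hom.isoOpensRange_hom_ι_assoc,
      Category.assoc, Iso.hom_inv_id_assoc, Scheme.Hom.isoOpensRange_hom_ι_assoc]
    change i₂ ≫ πH = (i₁' ≫ U₀.ι) ≫ f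
    rw [Category.assoc]
    change i₂ ≫ πH = i₁' ≫ g
    rw [← hπ, ← hi₁', Category.assoc, hjXπ]

end Summit.ResolutionOfSingularities.ResolutionOfSingularities.Theorems.Pialt.IndeterminacySplit

end
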